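import Literature.NumberTheory.Transcendental.KaehlerHodge
import Literature.NumberTheory.Transcendental.DolbeaultProofs
import Literature.NumberTheory.Transcendental.ComplexDeRhamRealStructure
import HarnessLib

/-!
# Conjugation and the `∂̄`-Laplacian: `\overline{ℋ^{p,q}} = ℋ^{q,p}` from the Kähler identity

Theorems-only companion of `Literature/NumberTheory/Transcendental/KaehlerHodge.lean`, towards the
named fact `Literature.NumberTheory.Transcendental.dolbeaultHarmonicForms_conj` (on a Kähler manifold
complex conjugation maps the `∂̄`-harmonic `(p,q)`-forms onto the `∂̄`-harmonic `(q,p)`-forms).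

## Source

* C. Voisin, *Hodge Theory and Complex Algebraic Geometry I* (2002), §6.1.2, Theorem 6.7: on a
  Kähler manifold `Δ_∂ = Δ_∂̄ = ½ Δ_d`; Corollary 6.10: `ℋ^{p,q}`, the `(p,q)`-forms harmonic for
  `Δ_d`, "is also the set of forms of type `(p,q)` which are harmonic for `Δ_∂̄`" (by Thm. 6.7);
  §6.1.3, Corollary 6.12: `\overline{H^{p,q}} = H^{q,p}`.
* D. Huybrechts, *Complex Geometry* (2005), §3.2, Remarks 3.2.7 (i): "If `X` is Kähler … complex
  conjugation interchanges `ℋ^{p,q}_∂̄(X,g)` and `ℋ^{q,p}_∂̄(X,g)`" (via Prop. 3.1.12, the Kähler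
  identities, giving `Δ_∂ = Δ_∂̄`, Prop. 3.2.6 (ii)).

## Architecture of the printed proof and what is proved here

The argument has two parts.

1. (*Formal, any metric.*) Conjugation intertwines the two Laplacians:
   `Δ_∂̄ ᾱ = \overline{Δ_∂ α}` and `Δ_∂ ᾱ = \overline{Δ_∂̄ α}`. Indeed `∂̄ ᾱ = \overline{∂α}`,
   `∂ ᾱ = \overline{∂̄α}` (Voisin (2002), §2.3.1, proof of Lemma 2.28; in the tree:
   `dolbeaultBar_conj'`, `dolbeault_conj'`), and the `ℂ`-linear Hodge star is the complexification
   of the real one, hence commutes with conjugation (`MForm.cHodgeStar_conj` below, from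
   `MForm.re_conj`, `MForm.im_conj` of `ComplexDeRhamRealStructure.lean`), so
   `∂̄* ᾱ = -⋆∂⋆ᾱ = \overline{-⋆∂̄⋆α} = \overline{∂* α}` (Voisin (2002), §6.1.1, p. 141:
   "`∂̄α = \overline{∂(ᾱ)}`, and thus `∂̄*α = \overline{∂*(ᾱ)}`"). All of this is proved below,
   unconditionally: `dolbeaultBarAdjoint_conj`, `dolbeaultAdjoint_conj`, `dolbeaultLaplacian_conj`,
   `delLaplacian_conj`, and, for the Hodge–de Rham operators, `cmcoderiv_conj`,
   `cHodgeLaplacian_conj` (`Δ_d` is a real operator).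
2. (*The Kähler identity.*) `Δ_∂ = Δ_∂̄` on a Kähler manifold (Voisin Thm. 6.7 / Huybrechts
   Prop. 3.1.12 (iii)). In the tree this is the named fact
   `Literature.NumberTheory.Transcendental.dolbeaultLaplacian_eq_delLaplacian` (equivalently, for
   this purpose, `cHodgeLaplacian_eq_two_smul_dolbeaultLaplacian`, `Δ_d = 2Δ_∂̄`, together with
   reality of `Δ_d`); it is **not** proved in the tree (it needs the Lefschetz operator `L`, its
   adjoint `Λ` and `[Λ, ∂̄] = -i∂*` on forms, none of which exist yet).

Given 1, part 2 finishes the proof: if `α` is smooth of type `(p,q)` with `Δ_∂̄ α = 0` then `ᾱ` is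
smooth (`isSmoothForm_conj`), of type `(q,p)` (`IsOfType.conj`) and
`Δ_∂̄ ᾱ = \overline{Δ_∂ α} = \overline{Δ_∂̄ α} = 0`; since conjugation is an involution the
carriers `{∂̄-harmonic (p,q)-forms}` and `{∂̄-harmonic (q,p)-forms}` are exchanged, hence so are
their `ℂ`-spans (`Submodule.map_span` for the conjugate-linear `MForm.conjₛₗ`). This file therefore
proves the **reductions**

* `dolbeaultHarmonicForms_conj_of_dolbeaultLaplacian_eq_delLaplacian :
    dolbeaultLaplacian_eq_delLaplacian g o → dolbeaultHarmonicForms_conj g o`,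
* `dolbeaultHarmonicForms_conj_of_cHodgeLaplacian_eq_two_smul_dolbeaultLaplacian :
    cHodgeLaplacian_eq_two_smul_dolbeaultLaplacian g o → dolbeaultHarmonicForms_conj g o`,

so that the discharge of the **corrected** fact,
`dolbeaultHarmonicForms_conj_of_isManifold_complex_holds` (`KaehlerHodgeConjFact.lean`: the old
`Prop` with the holomorphic atlas `[IsManifold 𝓘(ℂ, E) ω M]` as a binder of the `def`, definitionally
the old one at a complex manifold), is one line once either corrected Kähler identity is discharged
(glue `…_of_dolbeaultLaplacian_eq_delLaplacian`, `…_of_cHodgeLaplacian_eq_two_smul`,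
`…_of_kaehlerIdentities` there). The old fact itself can never be discharged: as elaborated it lacks
the holomorphic-atlas binder (next section) and is **false** in that generality —
`not_dolbeaultHarmonicForms_conj` (`KaehlerHodgeConjCounterexample.lean`: `ℂ²` with the chart
`(z, w) ↦ (z, w̄)` preferred at the origin, the flat metric, `α = (z̄ + 1) w̄ dz`). No new named fact is
introduced here.

## Caveat on the binders of the facts involved

`dolbeaultHarmonicForms_conj`, `dolbeaultLaplacian_eq_delLaplacian` and
`cHodgeLaplacian_eq_two_smul_dolbeaultLaplacian` are `def … : Prop`s written after a section
`variable [IsManifold 𝓘(ℂ, E) ω M]`; their bodies do not mention that instance, so it is **not**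
among their binders (`#check @dolbeaultHarmonicForms_conj`): as `Prop` families they range over
every real `C^∞` manifold with `E`-valued charts carrying a smooth metric that is formally Kähler,
whereas the sources assume a complex manifold (holomorphic atlas). The reductions below are
insensitive to this (they hold instance-wise), but a closed discharge of the Kähler identities
should be expected only for the complex-manifold restatements (cf. the *Correction* note in
`Literature/Geometry/Kaehler/Kaehler.lean` for the same phenomenon).

## References

* C. Voisin, *Hodge Theory and Complex Algebraic Geometry I*, Cambridge Studies in Advanced
  Mathematics 76, CUP (2002), §2.3.1 (Lemma 2.28), §6.1.1 (p. 141), §6.1.2 (Thm. 6.7,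
  Cor. 6.10), §6.1.3 (Cor. 6.12). [cite: Voisin2002]
* D. Huybrechts, *Complex Geometry. An Introduction*, Universitext, Springer (2005), §3.1
  (Def. 3.1.3 `∂̄* = -⋆∂⋆`, Prop. 3.1.12), §3.2 (Prop. 3.2.6, Remarks 3.2.7 (i)). [cite: Huybrechts2005]
-/

noncomputable section

open scoped Manifold ContDiff Topology ComplexConjugate
open Bundle Module Set Finset

namespace Literature.NumberTheory.Transcendental

variable {E : Type*} [NormedAddCommGroup E] [NormedSpace ℂ E]
  {M : Type*} [TopologicalSpace M] [ChartedSpace E M] {k m : ℕ}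

/-! ### Conjugation: two more algebraic lemmas -/

section MForm
open Literature.Geometry.Kaehler (MForm)
open Literature.Geometry.Kaehler.MForm

/-- Conjugation of forms commutes with negation. [folklore] -/
@[simp]
theorem _root_.Literature.Geometry.Kaehler.MForm.conj_neg (α : MForm 𝓘(ℝ, E) M ℂ k) :
    (-α).conj = -α.conj := by
  funext x; ext v; simp

/-- **`d ᾱ = \overline{dα}`**, the named fact `mextDeriv_conj` in applied (rewritable) form, fed
`mextDeriv_conj_holds` of `ComplexFormsProofs.lean`. Wells (1980), Ch. I §3; Voisin (2002),
§2.3.1. [cite: Voisin2002, §2.3.1] -/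
theorem mextDeriv_conj' (α : MForm 𝓘(ℝ, E) M ℂ k) :
    Literature.Geometry.Kaehler.mextDeriv α.conj = (Literature.Geometry.Kaehler.mextDeriv α).conj :=
  mextDeriv_conj_holds α

end MForm

/-! ### The complex Hodge star, `∂̄*`, `∂*` and the Laplacians under conjugation -/

section Riemannian

variable [FiniteDimensional ℂ E] {n : ℕ} [Fact (finrank ℝ E = n)]
  [RiemannianBundle (fun x : M ↦ TangentSpace 𝓘(ℝ, E) x)]
  (o : (x : M) → Orientation ℝ (TangentSpace 𝓘(ℝ, E) x) (Fin n))

/-- **The `ℂ`-linear Hodge star commutes with conjugation**, `⋆ᾱ = \overline{⋆α}`: it is the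
complexification `⋆(a + ib) = ⋆a + i⋆b` of the real Hodge star (Huybrechts (2005), §1.2, p. 33,
"extended `ℂ`-linearly"; Voisin (2002), §5.1.1). [cite: Huybrechts2005, §1.2 p. 33] -/
theorem _root_.Literature.Geometry.Kaehler.MForm.cHodgeStar_conj (h : k + m = n)
    (α : Literature.Geometry.Kaehler.MForm 𝓘(ℝ, E) M ℂ k) :
    Literature.Geometry.Kaehler.MForm.cHodgeStar o h α.conj =
      (Literature.Geometry.Kaehler.MForm.cHodgeStar o h α).conj := by
  funext x; ext v
  simp only [Literature.Geometry.Kaehler.MForm.cHodgeStar_apply,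
    Literature.Geometry.Kaehler.MForm.re_conj, Literature.Geometry.Kaehler.MForm.im_conj, map_neg,
    Pi.add_apply, Pi.smul_apply, Pi.neg_apply, ContinuousAlternatingMap.add_apply,
    ContinuousAlternatingMap.smul_apply, ContinuousAlternatingMap.neg_apply,
    Literature.Geometry.Kaehler.MForm.ofReal_apply, Literature.Geometry.Kaehler.MForm.conj_apply,
    map_add, map_mul, Complex.conj_ofReal, Complex.conj_I, smul_eq_mul, Complex.ofReal_neg]
  ring

/-- **`∂̄* ᾱ = \overline{∂* α}`** (`∂̄* = -⋆∂⋆`, `∂* = -⋆∂̄⋆`, `∂ᾱ = \overline{∂̄α}` and `⋆` real).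
Voisin (2002), §6.1.1, p. 141 ("`∂̄*α = \overline{∂*(ᾱ)}`"); Huybrechts (2005), Def. 3.1.3.
[cite: Voisin2002, §6.1.1 p. 141] -/
theorem dolbeaultBarAdjoint_conj (h : (k + 1) + m = n)
    (α : Literature.Geometry.Kaehler.MForm 𝓘(ℝ, E) M ℂ (k + 1)) :
    dolbeaultBarAdjoint o h α.conj = (dolbeaultAdjoint o h α).conj := by
  simp only [dolbeaultBarAdjoint, dolbeaultAdjoint, Literature.Geometry.Kaehler.MForm.cHodgeStar_conj,
    dolbeault_conj', Literature.Geometry.Kaehler.MForm.conj_neg]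

/-- **`∂* ᾱ = \overline{∂̄* α}`**. Voisin (2002), §6.1.1, p. 141; Huybrechts (2005), Def. 3.1.3.
[cite: Voisin2002, §6.1.1 p. 141] -/
theorem dolbeaultAdjoint_conj (h : (k + 1) + m = n)
    (α : Literature.Geometry.Kaehler.MForm 𝓘(ℝ, E) M ℂ (k + 1)) :
    dolbeaultAdjoint o h α.conj = (dolbeaultBarAdjoint o h α).conj := by
  simp only [dolbeaultBarAdjoint, dolbeaultAdjoint, Literature.Geometry.Kaehler.MForm.cHodgeStar_conj,
    dolbeaultBar_conj', Literature.Geometry.Kaehler.MForm.conj_neg]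

/-- **`Δ_∂̄ ᾱ = \overline{Δ_∂ α}`**: conjugation intertwines the `∂̄`- and the `∂`-Laplacian
(for any metric; no Kähler hypothesis). Huybrechts (2005), §3.2, Remarks 3.2.7 (i) (the mechanism
behind "complex conjugation interchanges `ℋ^{p,q}_∂̄` and `ℋ^{q,p}_∂̄`" on Kähler manifolds);
Voisin (2002), §6.1.1, p. 141. [cite: Huybrechts2005, §3.2 Rem. 3.2.7 (i)] -/
theorem dolbeaultLaplacian_conj (h : k + m = n) (α : Literature.Geometry.Kaehler.MForm 𝓘(ℝ, E) M ℂ k) :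
    dolbeaultLaplacian o k m h α.conj = (delLaplacian o k m h α).conj := by
  rcases k with - | k <;> rcases m with - | m
  · simp [dolbeaultLaplacian, delLaplacian, Literature.Geometry.Kaehler.MForm.conj_zero]
  · simp only [dolbeaultLaplacian, delLaplacian, dolbeaultBar_conj', dolbeaultBarAdjoint_conj]
  · simp only [dolbeaultLaplacian, delLaplacian, dolbeaultBarAdjoint_conj, dolbeaultBar_conj']
  · simp only [dolbeaultLaplacian, delLaplacian, dolbeaultBarAdjoint_conj, dolbeaultBar_conj',
      Literature.Geometry.Kaehler.MForm.conj_add]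

/-- **`Δ_∂ ᾱ = \overline{Δ_∂̄ α}`** (conjugate form of `dolbeaultLaplacian_conj`).
Huybrechts (2005), §3.2, Remarks 3.2.7 (i); Voisin (2002), §6.1.1, p. 141.
[cite: Huybrechts2005, §3.2 Rem. 3.2.7 (i)] -/
theorem delLaplacian_conj (h : k + m = n) (α : Literature.Geometry.Kaehler.MForm 𝓘(ℝ, E) M ℂ k) :
    delLaplacian o k m h α.conj = (dolbeaultLaplacian o k m h α).conj := by
  rw [← Literature.Geometry.Kaehler.MForm.conj_conj (delLaplacian o k m h α.conj),
    ← dolbeaultLaplacian_conj, Literature.Geometry.Kaehler.MForm.conj_conj]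

/-- **`δ ᾱ = \overline{δ α}`**: the complexified codifferential is a real operator (`δ = -⋆d⋆`,
`d ᾱ = \overline{dα}`, `⋆` real). Voisin (2002), §5.1.2; Warner (1983), 6.1. [cite: Voisin2002, §5.1.2] -/
theorem cmcoderiv_conj (h : (k + 1) + m = n)
    (α : Literature.Geometry.Kaehler.MForm 𝓘(ℝ, E) M ℂ (k + 1)) :
    cmcoderiv o h α.conj = (cmcoderiv o h α).conj := by
  rw [cmcoderiv_eq_neg, cmcoderiv_eq_neg, Literature.Geometry.Kaehler.MForm.cHodgeStar_conj,
    mextDeriv_conj', Literature.Geometry.Kaehler.MForm.cHodgeStar_conj,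
    Literature.Geometry.Kaehler.MForm.conj_neg]

/-- **`Δ_d ᾱ = \overline{Δ_d α}`**: the complexified Hodge–de Rham Laplacian is a real operator.
Voisin (2002), §5.1.2 / §6.1.2 (`Δ_d` real, used with Thm. 6.7 for Hodge symmetry); Warner (1983),
6.1. [cite: Voisin2002, §6.1.2] -/
theorem cHodgeLaplacian_conj (h : k + m = n) (α : Literature.Geometry.Kaehler.MForm 𝓘(ℝ, E) M ℂ k) :
    cHodgeLaplacian o k m h α.conj = (cHodgeLaplacian o k m h α).conj := by
  rcases k with - | k <;> rcases m with - | m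
  · simp [cHodgeLaplacian, Literature.Geometry.Kaehler.MForm.conj_zero]
  · simp only [cHodgeLaplacian, mextDeriv_conj', cmcoderiv_conj]
  · simp only [cHodgeLaplacian, cmcoderiv_conj, mextDeriv_conj']
  · simp only [cHodgeLaplacian, cmcoderiv_conj, mextDeriv_conj',
      Literature.Geometry.Kaehler.MForm.conj_add]

/-! ### `∂̄`-harmonic forms under conjugation -/

/-- If `α` is `∂̄`-harmonic of type `(p,q)` **and** `Δ_∂ α = 0`, then `ᾱ` is `∂̄`-harmonic of type
`(q,p)`: `ᾱ` is smooth, of type `(q,p)`, and `Δ_∂̄ ᾱ = \overline{Δ_∂ α} = 0`. On a Kähler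
manifold the extra hypothesis is automatic (`Δ_∂ = Δ_∂̄`, Voisin (2002), Thm. 6.7). Huybrechts
(2005), §3.2, Remarks 3.2.7 (i). [cite: Huybrechts2005, §3.2 Rem. 3.2.7 (i)] -/
theorem IsDolbeaultHarmonic.conj {p q : ℕ} {h : k + m = n}
    {α : Literature.Geometry.Kaehler.MForm 𝓘(ℝ, E) M ℂ k} (hα : IsDolbeaultHarmonic o p q h α)
    (hΔ : delLaplacian o k m h α = 0) : IsDolbeaultHarmonic o q p h α.conj :=
  ⟨isSmoothForm_conj hα.1, hα.2.1.conj, by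
    rw [dolbeaultLaplacian_conj, hΔ, Literature.Geometry.Kaehler.MForm.conj_zero]⟩

/-- From forms to spaces: if conjugation maps `∂̄`-harmonic `(p,q)`-forms to `∂̄`-harmonic
`(q,p)`-forms for all `(p,q)` (in the fixed degree `k`), then it maps `ℋ^{p,q}` onto `ℋ^{q,p}`
(conjugation is an involution, and `map` of a span under the conjugate-linear `MForm.conjₛₗ` is the
span of the image). Huybrechts (2005), §3.2, Remarks 3.2.7 (i). [cite: Huybrechts2005, §3.2 Rem. 3.2.7 (i)] -/
theorem dolbeaultHarmonicForms_map_conjₛₗ_of (h : k + m = n)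
    (H : ∀ (p q : ℕ) (α : Literature.Geometry.Kaehler.MForm 𝓘(ℝ, E) M ℂ k),
      IsDolbeaultHarmonic o p q h α → IsDolbeaultHarmonic o q p h α.conj)
    (p q : ℕ) :
    (dolbeaultHarmonicForms o p q h).map (Literature.Geometry.Kaehler.MForm.conjₛₗ k) =
      dolbeaultHarmonicForms o q p h := by
  rw [dolbeaultHarmonicForms, Submodule.map_span, dolbeaultHarmonicForms]
  congr 1
  ext β
  simp only [Set.mem_image, Set.mem_setOf_eq, Literature.Geometry.Kaehler.MForm.conjₛₗ_apply]
  constructor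
  · rintro ⟨α, hα, rfl⟩
    exact H p q α hα
  · intro hβ
    exact ⟨β.conj, H q p β hβ, Literature.Geometry.Kaehler.MForm.conj_conj β⟩

end Riemannian

/-! ### The reductions to the Kähler identities -/

section Kaehler

variable [FiniteDimensional ℂ E] {n : ℕ} [Fact (finrank ℝ E = n)]
  [IsManifold 𝓘(ℂ, E) ω M] [IsManifold 𝓘(ℝ, E) ∞ M]
  (g : ContMDiffRiemannianMetric 𝓘(ℝ, E) ∞ E (fun x : M ↦ TangentSpace 𝓘(ℝ, E) x))
  (o : (x : M) → Orientation ℝ (TangentSpace 𝓘(ℝ, E) x) (Fin n))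

omit [IsManifold 𝓘(ℂ, E) ω M] in
/-- **`\overline{ℋ^{p,q}} = ℋ^{q,p}` from the Kähler identity `Δ_∂̄ = Δ_∂`.** If the named fact
`dolbeaultLaplacian_eq_delLaplacian g o` holds (Voisin (2002), Thm. 6.7; Huybrechts (2005),
Prop. 3.1.12 (iii)), then conjugation maps `ℋ^{p,q}` onto `ℋ^{q,p}` for the Kähler metric `g`:
for a `∂̄`-harmonic `(p,q)`-form `α`, `Δ_∂̄ ᾱ = \overline{Δ_∂ α} = \overline{Δ_∂̄ α} = 0`
(`dolbeaultLaplacian_conj`). This is the printed proof of Huybrechts (2005), §3.2,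
Remarks 3.2.7 (i) / Voisin (2002), Cor. 6.10, with the Kähler identity as hypothesis.
[cite: Voisin2002, §6.1.2 Thm. 6.7, Cor. 6.10] -/
theorem dolbeaultHarmonicForms_conj_of_dolbeaultLaplacian_eq_delLaplacian
    (hK : dolbeaultLaplacian_eq_delLaplacian g o (k := k) (m := m)) :
    dolbeaultHarmonicForms_conj g o (k := k) (m := m) := by
  intro hg h p q
  letI : RiemannianBundle (fun x : M ↦ TangentSpace 𝓘(ℝ, E) x) := ⟨g.toRiemannianMetric⟩
  intro ho
  refine dolbeaultHarmonicForms_map_conjₛₗ_of o h (fun p q α hα ↦ hα.conj o ?_) p q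
  rw [← hK hg h hα.1 ho]
  exact hα.2.2

omit [IsManifold 𝓘(ℂ, E) ω M] in
/-- **`\overline{ℋ^{p,q}} = ℋ^{q,p}` from the Kähler identity `Δ_d = 2Δ_∂̄`.** If the named fact
`cHodgeLaplacian_eq_two_smul_dolbeaultLaplacian g o` holds (Voisin (2002), Thm. 6.7;
Huybrechts (2005), Prop. 3.1.12 (iii)), then conjugation maps `ℋ^{p,q}` onto `ℋ^{q,p}`: for a
`∂̄`-harmonic `(p,q)`-form `α`, `2Δ_∂̄ ᾱ = Δ_d ᾱ = \overline{Δ_d α} = \overline{2Δ_∂̄ α} = 0`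
(`Δ_d` is real, `cHodgeLaplacian_conj`). This is Voisin's route (Cor. 6.10: `ℋ^{p,q}` = the
`(p,q)`-forms harmonic for `Δ_d`, a real operator). [cite: Voisin2002, §6.1.2 Thm. 6.7, Cor. 6.10] -/
theorem dolbeaultHarmonicForms_conj_of_cHodgeLaplacian_eq_two_smul_dolbeaultLaplacian
    (hK : cHodgeLaplacian_eq_two_smul_dolbeaultLaplacian g o (k := k) (m := m)) :
    dolbeaultHarmonicForms_conj g o (k := k) (m := m) := by
  intro hg h p q
  letI : RiemannianBundle (fun x : M ↦ TangentSpace 𝓘(ℝ, E) x) := ⟨g.toRiemannianMetric⟩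
  intro ho
  refine dolbeaultHarmonicForms_map_conjₛₗ_of o h (fun p q α hα ↦ ?_) p q
  refine ⟨isSmoothForm_conj hα.1, hα.2.1.conj, ?_⟩
  have h2 : (2 : ℂ) • dolbeaultLaplacian o k m h α.conj = 0 := by
    rw [← hK hg h (isSmoothForm_conj hα.1) ho, cHodgeLaplacian_conj, hK hg h hα.1 ho, hα.2.2,
      smul_zero, Literature.Geometry.Kaehler.MForm.conj_zero]
  exact (smul_eq_zero.mp h2).resolve_left two_ne_zero

end Kaehler

end Literature.NumberTheory.Transcendental
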